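import Summits.BirchSwinnertonDyer.BirchSwinnertonDyer.Theorems.ResidualThetaTransportAtTwoThetaLayerLambdaCongruenceAtTwoCuspSpanFourInvariance
import HarnessLib

/-!
# Route `ResidualThetaTransportAtTwo`, node (G′)_N = `CuspSpanEvenAtTwo N` (item 27436; cruxes Kan⁺ 20688 / Kμ⁺ 20689 / 21437):
# TWO MORE CLASS-WIDE FAMILIES OF PRIME LEVELS — `(ℤ/p)ˣ = ⟨4, i⟩` (index 2) and `(ℤ/p)ˣ = ⟨−1, 4, ρ⟩` (index 3)

Cell `bsd-wall`, width seat `bsd-wall-rtt-p3-w3` g7 (2026-08-28). THEOREMS ONLY (no `def`, no `sorry`, no named fact);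
`--supports stmt-BirchSwinnertonDyer-20688`; BSD is not proved by this. The node stays a hypothesis at every level not covered.

INPUT (all kernel): the lead's Theorem A machinery (`…CuspSpanGeneration`, `…CuspSpanGenerationB1`: descent to the `b = −1`
elements `B₁` at prime level, the `B₁`-character `F(u) = χ(β_u)`, seeds `F(±4^k) = 0`, `F(d) = 0` for `d² + td + 1 ≡ 0`,
`|t| ≤ 1`) and the lead's 4-INVARIANCE `F(4u) = F(u)` at every odd prime level (`…CuspSpanFourInvariance`, p628791, Dirichlet)
together with `F(−1/u) = F(u)` (any level).

* THEOREM B′ (`cuspSpanTrace_of_units_four_pow_mul_rootNegOne_pow`, `cuspSpanEvenAtTwo_of_…`). Let `p` be an odd prime,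
  `i ∈ ℤ/p` with `i² = −1`, and suppose every unit of `ℤ/p` is `4^k · i^j`. Then every admissible `χ` (additive, killing the
  elements of trace `0, ±1, ±2` and the `4^k`-classes) VANISHES, so (G″)_p holds with `ψ = 0` and `CuspSpanEvenAtTwo p`.
  PROOF: `F(4^k i^j) = F(i^j)` (4-invariance, `k` times) and `i^j ∈ {1, i, −1, −i}`: `F(1) = 0` (parabolic), `F(±i) = 0`
  (elliptic seeds, `t = 0`), `F(−1) = F(1)` (`(−1)·1 = −1`). The hypothesis says `(ℤ/p)ˣ = ⟨4, i⟩`, i.e. `[(ℤ/p)ˣ : ⟨4⟩] ≤ 4`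
  with `i ∉ ⟨4⟩` unless Theorem A applies; it holds exactly at the primes `p ≡ 5 (mod 8)` for which `2` is a primitive root
  (`29, 37, 53, 61, 101, 149, 173, 181, 197, 269, 293, 317, 349, 373, 389, 421, 461, 509, 541, 557, …` — an infinite set under
  Artin/GRH; unconditionally a set the tree can only enumerate) and at the Theorem-A primes `≡ 1 (mod 4)` (none).
* THEOREM E′ (`cuspSpanTrace_of_units_pm_four_pow_mul_rootCube_pow`, `cuspSpanEvenAtTwo_of_…`). Let `p` be an odd prime,
  `ρ ∈ ℤ/p` with `ρ² + ρ + 1 = 0`, and suppose every unit is `±4^k · ρ^j`. Then again every admissible `χ` vanishes and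
  `CuspSpanEvenAtTwo p`. PROOF: `F(±4^k ρ^j) = F(±ρ^j)`; `F(ρ) = F(ρ²) = 0` (elliptic seeds, `t = 1`), `F(1) = 0`;
  `F(−ρ^j) = F(ρ^{−j})` (`(−ρ^j) ρ^{−j} = −1`). The hypothesis says `(ℤ/p)ˣ = ⟨−1, 4, ρ⟩` (index of `±⟨4⟩` divides `3`):
  `p = 31, 43, 223, 229, 283, 397, 439, 457, 499, …` (`43` is the theta-habitat Serre conductor `d = 43` of the TP2 census).
* INSTANCES (§4): with a primitive root `g` the hypotheses are three `decide +kernel` checks; levels `317, 349` (B′) and `439` (E′)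
  here, `p < 1100` in the sequel `…CuspSpanEllipticFamiliesTable` (members `≤ 300` already have per-level certificates in the tree).
LIMITS (recorded, not attempted): seed-only uniformity stops at `[(ℤ/p)ˣ : ±⟨4⟩] ∈ {1, 2, 3}` — order-12 roots `i·ρ` are not
elliptic seeds; index `4` with `p ≡ 9 (mod 16)` gives `F = c·(Legendre)` (Eisenstein, needs the quadratic-character assembly);
in general the three-term relations must supply cyclotomic pairs (positivity of cyclotomic numbers of order `[(ℤ/p)ˣ : ⟨4⟩]`,
a Jacobi-sum estimate) — that road would give the node at every prime with `ord_p 4 ≳ p^{3/4}`.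

References: H. Rademacher, Abh. Math. Sem. Hamburg 7 (1929) §1 [Rademacher1929]; A. W. Knapp, *Elliptic curves* (1992)
Prop. 11.1, 11.22 [Knapp1993]; R. Pollack, Duke Math. J. 118 (2003) Conj. 6.3 [Pollack2003]; C. Hooley, J. reine angew. Math. 225
(1967) (Artin's conjecture) [Hooley1967].
-/

set_option autoImplicit false
set_option linter.dupNamespace false

noncomputable section

open scoped MatrixGroups

open CongruenceSubgroup

namespace Summit.BirchSwinnertonDyer.BirchSwinnertonDyer.Theorems.SignedMuAtTwo

variable {p : ℕ} [Fact p.Prime] {χ : Gamma0 p → ZMod 2}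

/-! ## §1. Iterated 4-invariance and the elementary zeros of the `B₁`-character -/

/-- **`F(4^k u) = F(u)`**: for `b = −1` elements `β, β'` of `Γ₀(p)` with `d(β) ≡ 4^k d(β')`, `χ β = χ β'`
(the lead's `chi_eq_of_b_neg_one_of_d_eq_four_mul`, iterated). [cite: Pollack2003, Conj. 6.3] -/
theorem chi_eq_of_b_neg_one_of_d_eq_four_pow_mul (hp2 : p ≠ 2)
    (hadd : ∀ γ δ : Gamma0 p, χ (γ * δ) = χ γ + χ δ)
    (hsmall : ∀ γ : Gamma0 p, ((γ : SL(2, ℤ)) 0 0 + (γ : SL(2, ℤ)) 1 1).natAbs ≤ 2 → χ γ = 0)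
    (hkill : ∀ γ : Gamma0 p, (∃ k : ℕ, 1 ≤ k ∧ ((γ : SL(2, ℤ)) 1 1).natAbs = 4 ^ k) → χ γ = 0) (k : ℕ) :
    ∀ {β β' : Gamma0 p}, (β : SL(2, ℤ)) 0 1 = -1 → (β' : SL(2, ℤ)) 0 1 = -1 →
      ((((β : SL(2, ℤ)) 1 1 : ℤ) : ZMod p)) = 4 ^ k * ((((β' : SL(2, ℤ)) 1 1 : ℤ) : ZMod p)) → χ β = χ β' := by
  induction k with
  | zero =>
    intro β β' hb hb' h
    rw [pow_zero, one_mul] at h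
    exact chi_eq_of_apply_zero_one_eq_neg_one hadd hsmall hb hb' h
  | succ k ih =>
    intro β β' hb hb' h
    -- intermediate element with residue `4^k d(β')`
    have hu : IsUnit ((4 : ZMod p) ^ k * ((((β' : SL(2, ℤ)) 1 1 : ℤ) : ZMod p))) := by
      have hβu := isUnit_gamma0_apply_one_one β
      rw [h] at hβu
      have h4 : IsUnit (4 : ZMod p) := (isUnit_pow_iff (Nat.succ_ne_zero k)).mp (isUnit_of_mul_isUnit_left hβu)
      exact (h4.pow k).mul (isUnit_gamma0_apply_one_one β')
    obtain ⟨β₁, hb1, hd1⟩ := exists_b_neg_one_of_isUnit (N := p) hu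
    rw [chi_eq_of_b_neg_one_of_d_eq_four_mul hp2 hadd hsmall hkill hb hb1 (by rw [h, hd1]; ring),
      ih hb1 hb' hd1]

/-- **`F(1) = 0`, `F(−1) = 0`, `F(d) = 0` for `d² = −1` and for `d² + d + 1 = 0`** — the elementary zeros of the
`B₁`-character: the parabolic `(1, −1; 0, 1)`; `(−1)·1 = −1` (`F(−1/u) = F(u)`); the elliptic seeds of
`…CuspSpanGenerationB1` with `t = 0` and `t = 1`. [cite: Knapp1993, Prop. 11.1] -/
theorem chi_eq_zero_of_b_neg_one_of_elementary
    (hadd : ∀ γ δ : Gamma0 p, χ (γ * δ) = χ γ + χ δ)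
    (hsmall : ∀ γ : Gamma0 p, ((γ : SL(2, ℤ)) 0 0 + (γ : SL(2, ℤ)) 1 1).natAbs ≤ 2 → χ γ = 0)
    {β : Gamma0 p} (hb : (β : SL(2, ℤ)) 0 1 = -1) {x : ZMod p} (hd : ((((β : SL(2, ℤ)) 1 1 : ℤ) : ZMod p)) = x)
    (hx : x = 1 ∨ x = -1 ∨ x * x = -1 ∨ x * x + x + 1 = 0) : χ β = 0 := by
  -- the parabolic `T' = (1, −1; 0, 1)` has residue `1`
  obtain ⟨T, hT00, hT01, hT10, hT11⟩ :=
    ThetaLayerLambdaCongruenceAtTwo.exists_gamma0_entries (N := p) 1 (-1) 0 1 (by norm_num) (dvd_zero _)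
  have hT : χ T = 0 := hsmall T (by rw [hT00, hT11]; rfl)
  have hTres : ((((T : SL(2, ℤ)) 1 1 : ℤ) : ZMod p)) = 1 := by rw [hT11]; push_cast; rfl
  rcases hx with hx | hx | hx | hx
  · rw [chi_eq_of_apply_zero_one_eq_neg_one hadd hsmall hb hT01 (by rw [hd, hx, hTres]), hT]
  · rw [chi_eq_of_b_neg_one_of_mul_d_eq_neg_one hadd hsmall hb hT01 (by rw [hd, hx, hTres]; ring), hT]
  · -- `x² = −1`: elliptic seed with `t = 0`
    refine chi_eq_zero_of_b_neg_one_of_elliptic hadd hsmall β hb (x.val : ℤ) 0 (by decide) ?_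
      (by rw [hd, Int.cast_natCast, ZMod.natCast_zmod_val])
    refine (ZMod.intCast_zmod_eq_zero_iff_dvd _ p).mp ?_
    push_cast; rw [ZMod.natCast_zmod_val]; linear_combination hx
  · -- `x² + x + 1 = 0`: elliptic seed with `t = 1`
    refine chi_eq_zero_of_b_neg_one_of_elliptic hadd hsmall β hb (x.val : ℤ) 1 (by decide) ?_
      (by rw [hd, Int.cast_natCast, ZMod.natCast_zmod_val])
    refine (ZMod.intCast_zmod_eq_zero_iff_dvd _ p).mp ?_
    push_cast; rw [ZMod.natCast_zmod_val]; linear_combination hx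

/-! ## §2. THEOREM B′ — `(ℤ/p)ˣ = ⟨4, i⟩` -/

/-- **THEOREM B′ (character form).** `p` an odd prime, `i² = −1` in `ℤ/p`, every unit of the form `4^k i^j`: then every
additive `χ : Γ₀(p) → ZMod 2` killing the elements of trace `0, ±1, ±2` and the `4^k`-classes vanishes identically.
[cite: Pollack2003, Conj. 6.3] [cite: Rademacher1929, §1] -/
theorem chi_eq_zero_of_units_four_pow_mul_rootNegOne_pow (hp2 : p ≠ 2) (i : ZMod p) (hi : i * i = -1)
    (hU : ∀ u : ZMod p, u ≠ 0 → ∃ k j : ℕ, u = 4 ^ k * i ^ j)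
    (hadd : ∀ γ δ : Gamma0 p, χ (γ * δ) = χ γ + χ δ)
    (hsmall : ∀ γ : Gamma0 p, ((γ : SL(2, ℤ)) 0 0 + (γ : SL(2, ℤ)) 1 1).natAbs ≤ 2 → χ γ = 0)
    (hkill : ∀ γ : Gamma0 p, (∃ k : ℕ, 1 ≤ k ∧ ((γ : SL(2, ℤ)) 1 1).natAbs = 4 ^ k) → χ γ = 0) :
    ∀ γ : Gamma0 p, χ γ = 0 := by
  have hp : p.Prime := Fact.out
  -- every `b = −1` element is killed
  have hB : ∀ β : Gamma0 p, (β : SL(2, ℤ)) 0 1 = -1 → χ β = 0 := by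
    intro β hb
    have hu := isUnit_gamma0_apply_one_one β
    obtain ⟨k, j, hkj⟩ := hU _ hu.ne_zero
    have hij : IsUnit (i ^ j) := by
      have : IsUnit (i * i) := by rw [hi]; exact isUnit_one.neg
      exact (isUnit_of_mul_isUnit_left this).pow j
    obtain ⟨β', hb', hd'⟩ := exists_b_neg_one_of_isUnit (N := p) hij
    rw [chi_eq_of_b_neg_one_of_d_eq_four_pow_mul hp2 hadd hsmall hkill k hb hb' (by rw [hkj, hd'])]
    -- `i^j ∈ {1, i, −1, −i}` according to `j mod 4`
    refine chi_eq_zero_of_b_neg_one_of_elementary hadd hsmall hb' hd' ?_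
    have hi4 : i ^ 4 = 1 := by
      calc i ^ 4 = (i * i) * (i * i) := by ring
        _ = 1 := by rw [hi]; ring
    have hj : i ^ j = i ^ (j % 4) := by
      conv_lhs => rw [← Nat.div_add_mod j 4, pow_add, pow_mul, hi4, one_pow, one_mul]
    have hlt : j % 4 < 4 := Nat.mod_lt _ (by norm_num)
    rw [hj]
    interval_cases (j % 4)
    · exact Or.inl (pow_zero _)
    · right; right; left; rw [pow_one, hi]
    · right; left; rw [pow_two, hi]
    · right; right; left
      calc i ^ 3 * i ^ 3 = (i * i) * (i * i) * (i * i) := by ring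
        _ = -1 := by rw [hi]; ring
  have hsucc : ∀ δ : ℤ, IsUnit ((δ : ℤ) : ZMod p) ∨ IsUnit (((δ + 1 : ℤ)) : ZMod p) := by
    intro δ
    have h := isUnit_or_isUnit_succ_of_primePow (p := p) (e := 1) hp δ
    rw [pow_one] at h
    exact h
  intro γ
  exact chi_eq_zero_of_forall_b1 hsucc hadd hsmall (forall_b1_of_forall_b_neg_one hadd hB) γ

/-- **THEOREM B′ (trace form (G″)_p with `ψ = 0`).** [cite: Pollack2003, Conj. 6.3] -/
theorem cuspSpanTrace_of_units_four_pow_mul_rootNegOne_pow (hp2 : p ≠ 2) (i : ZMod p) (hi : i * i = -1)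
    (hU : ∀ u : ZMod p, u ≠ 0 → ∃ k j : ℕ, u = 4 ^ k * i ^ j) :
    ∀ χ : Gamma0 p → ZMod 2,
      (∀ γ δ : Gamma0 p, χ (γ * δ) = χ γ + χ δ) →
      (∀ γ : Gamma0 p, ((γ : SL(2, ℤ)) 0 0 + (γ : SL(2, ℤ)) 1 1).natAbs ≤ 2 → χ γ = 0) →
      (∀ γ : Gamma0 p, (∃ k : ℕ, 1 ≤ k ∧ ((γ : SL(2, ℤ)) 1 1).natAbs = 4 ^ k) → χ γ = 0) →
      ∃ ψ : ZMod p → ZMod 2, (∀ x y : ZMod p, IsUnit x → IsUnit y → ψ (x * y) = ψ x + ψ y) ∧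
        ∀ γ : Gamma0 p, χ γ = ψ ((((γ : SL(2, ℤ)) 1 1 : ℤ) : ZMod p)) := by
  intro χ hadd hsmall hkill
  exact ⟨fun _ ↦ 0, fun _ _ _ _ ↦ by simp,
    fun γ ↦ chi_eq_zero_of_units_four_pow_mul_rootNegOne_pow hp2 i hi hU hadd hsmall hkill γ⟩

/-- **THEOREM B′ (the named node).** For an odd prime `p` with `i² = −1` in `ℤ/p` and `(ℤ/p)ˣ = {4^k i^j}`:
`CuspSpanEvenAtTwo p`. [cite: Pollack2003, Conj. 6.3] -/
theorem cuspSpanEvenAtTwo_of_units_four_pow_mul_rootNegOne_pow (hp2 : p ≠ 2) (i : ZMod p) (hi : i * i = -1)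
    (hU : ∀ u : ZMod p, u ≠ 0 → ∃ k j : ℕ, u = 4 ^ k * i ^ j) : CuspSpanEvenAtTwo p :=
  cuspSpanEvenAtTwo_of_cuspSpanTrace (cuspSpanTrace_of_units_four_pow_mul_rootNegOne_pow hp2 i hi hU)

/-! ## §3. THEOREM E′ — `(ℤ/p)ˣ = ⟨−1, 4, ρ⟩` -/

/-- **THEOREM E′ (character form).** `p` an odd prime, `ρ² + ρ + 1 = 0` in `ℤ/p`, every unit of the form `±4^k ρ^j`: then every
admissible `χ` vanishes identically. [cite: Pollack2003, Conj. 6.3] [cite: Rademacher1929, §1] -/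
theorem chi_eq_zero_of_units_pm_four_pow_mul_rootCube_pow (hp2 : p ≠ 2) (ρ : ZMod p) (hρ : ρ * ρ + ρ + 1 = 0)
    (hU : ∀ u : ZMod p, u ≠ 0 → ∃ k j : ℕ, u = 4 ^ k * ρ ^ j ∨ u = -(4 ^ k * ρ ^ j))
    (hadd : ∀ γ δ : Gamma0 p, χ (γ * δ) = χ γ + χ δ)
    (hsmall : ∀ γ : Gamma0 p, ((γ : SL(2, ℤ)) 0 0 + (γ : SL(2, ℤ)) 1 1).natAbs ≤ 2 → χ γ = 0)
    (hkill : ∀ γ : Gamma0 p, (∃ k : ℕ, 1 ≤ k ∧ ((γ : SL(2, ℤ)) 1 1).natAbs = 4 ^ k) → χ γ = 0) :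
    ∀ γ : Gamma0 p, χ γ = 0 := by
  have hp : p.Prime := Fact.out
  have hρ3 : ρ ^ 3 = 1 := by
    calc ρ ^ 3 = ρ * (ρ * ρ + ρ + 1) - (ρ * ρ + ρ + 1) + 1 := by ring
      _ = 1 := by rw [hρ]; ring
  have hρu : IsUnit ρ := IsUnit.of_mul_eq_one (ρ ^ 2) (by rw [← pow_succ', hρ3])
  -- `F(ρ^j) = 0` for every `j`
  have hzero : ∀ j : ℕ, ∀ β : Gamma0 p, (β : SL(2, ℤ)) 0 1 = -1 →
      ((((β : SL(2, ℤ)) 1 1 : ℤ) : ZMod p)) = ρ ^ j → χ β = 0 := by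
    intro j β hb hd
    refine chi_eq_zero_of_b_neg_one_of_elementary hadd hsmall hb hd ?_
    have hj : ρ ^ j = ρ ^ (j % 3) := by
      conv_lhs => rw [← Nat.div_add_mod j 3, pow_add, pow_mul, hρ3, one_pow, one_mul]
    have hlt : j % 3 < 3 := Nat.mod_lt _ (by norm_num)
    rw [hj]
    interval_cases (j % 3)
    · exact Or.inl (pow_zero _)
    · right; right; right; rw [pow_one, hρ]
    · right; right; right
      calc ρ ^ 2 * ρ ^ 2 + ρ ^ 2 + 1 = ρ * (ρ ^ 3) + ρ * ρ + 1 := by ring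
        _ = 0 := by rw [hρ3, mul_one]; linear_combination hρ
  have hB : ∀ β : Gamma0 p, (β : SL(2, ℤ)) 0 1 = -1 → χ β = 0 := by
    intro β hb
    have hu := isUnit_gamma0_apply_one_one β
    obtain ⟨k, j, hkj⟩ := hU _ hu.ne_zero
    rcases hkj with hkj | hkj
    · obtain ⟨β', hb', hd'⟩ := exists_b_neg_one_of_isUnit (N := p) (hρu.pow j)
      rw [chi_eq_of_b_neg_one_of_d_eq_four_pow_mul hp2 hadd hsmall hkill k hb hb' (by rw [hkj, hd'])]
      exact hzero j β' hb' hd'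
    · -- `−ρ^j`: strip `4^k`, then `F(−ρ^j) = F(ρ^{2j})` since `(−ρ^j) ρ^{2j} = −ρ^{3j} = −1`
      obtain ⟨β', hb', hd'⟩ := exists_b_neg_one_of_isUnit (N := p) (hρu.pow j).neg
      obtain ⟨β'', hb'', hd''⟩ := exists_b_neg_one_of_isUnit (N := p) (hρu.pow (2 * j))
      rw [chi_eq_of_b_neg_one_of_d_eq_four_pow_mul hp2 hadd hsmall hkill k hb hb' (by rw [hkj, hd']; ring),
        chi_eq_of_b_neg_one_of_mul_d_eq_neg_one hadd hsmall hb' hb'' ?_]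
      · exact hzero (2 * j) β'' hb'' hd''
      · rw [hd', hd'']
        calc -ρ ^ j * ρ ^ (2 * j) = -((ρ ^ 3) ^ j) := by ring
          _ = -1 := by rw [hρ3, one_pow]
  have hsucc : ∀ δ : ℤ, IsUnit ((δ : ℤ) : ZMod p) ∨ IsUnit (((δ + 1 : ℤ)) : ZMod p) := by
    intro δ
    have h := isUnit_or_isUnit_succ_of_primePow (p := p) (e := 1) hp δ
    rw [pow_one] at h
    exact h
  intro γ
  exact chi_eq_zero_of_forall_b1 hsucc hadd hsmall (forall_b1_of_forall_b_neg_one hadd hB) γ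

/-- **THEOREM E′ (trace form (G″)_p with `ψ = 0`).** [cite: Pollack2003, Conj. 6.3] -/
theorem cuspSpanTrace_of_units_pm_four_pow_mul_rootCube_pow (hp2 : p ≠ 2) (ρ : ZMod p) (hρ : ρ * ρ + ρ + 1 = 0)
    (hU : ∀ u : ZMod p, u ≠ 0 → ∃ k j : ℕ, u = 4 ^ k * ρ ^ j ∨ u = -(4 ^ k * ρ ^ j)) :
    ∀ χ : Gamma0 p → ZMod 2,
      (∀ γ δ : Gamma0 p, χ (γ * δ) = χ γ + χ δ) →
      (∀ γ : Gamma0 p, ((γ : SL(2, ℤ)) 0 0 + (γ : SL(2, ℤ)) 1 1).natAbs ≤ 2 → χ γ = 0) →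
      (∀ γ : Gamma0 p, (∃ k : ℕ, 1 ≤ k ∧ ((γ : SL(2, ℤ)) 1 1).natAbs = 4 ^ k) → χ γ = 0) →
      ∃ ψ : ZMod p → ZMod 2, (∀ x y : ZMod p, IsUnit x → IsUnit y → ψ (x * y) = ψ x + ψ y) ∧
        ∀ γ : Gamma0 p, χ γ = ψ ((((γ : SL(2, ℤ)) 1 1 : ℤ) : ZMod p)) := by
  intro χ hadd hsmall hkill
  exact ⟨fun _ ↦ 0, fun _ _ _ _ ↦ by simp,
    fun γ ↦ chi_eq_zero_of_units_pm_four_pow_mul_rootCube_pow hp2 ρ hρ hU hadd hsmall hkill γ⟩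

/-- **THEOREM E′ (the named node).** For an odd prime `p` with `ρ² + ρ + 1 = 0` in `ℤ/p` and `(ℤ/p)ˣ = {±4^k ρ^j}`:
`CuspSpanEvenAtTwo p`. [cite: Pollack2003, Conj. 6.3] -/
theorem cuspSpanEvenAtTwo_of_units_pm_four_pow_mul_rootCube_pow (hp2 : p ≠ 2) (ρ : ZMod p) (hρ : ρ * ρ + ρ + 1 = 0)
    (hU : ∀ u : ZMod p, u ≠ 0 → ∃ k j : ℕ, u = 4 ^ k * ρ ^ j ∨ u = -(4 ^ k * ρ ^ j)) : CuspSpanEvenAtTwo p :=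
  cuspSpanEvenAtTwo_of_cuspSpanTrace (cuspSpanTrace_of_units_pm_four_pow_mul_rootCube_pow hp2 ρ hρ hU)

/-! ## §4. Instances: a primitive root makes the hypotheses one-line `decide` checks -/

/-- `orderOf x = n` from `x^n = 1` and `x^(n/q) ≠ 1` for every divisor `2 ≤ q ≤ n` of `n` (a `decide`-friendly form of
Mathlib's `orderOf_eq_of_pow_and_pow_div_prime`). [folklore] -/
theorem orderOf_eq_of_pow_eq_one_of_forall_dvd {M : Type*} [Monoid M] (x : M) (n : ℕ) (hn : 0 < n) (h1 : x ^ n = 1)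
    (h2 : ∀ q, q < n + 1 → 2 ≤ q → q ∣ n → x ^ (n / q) ≠ 1) : orderOf x = n :=
  orderOf_eq_of_pow_and_pow_div_prime hn h1
    (fun q hq hqd ↦ h2 q (Nat.lt_succ_of_le (Nat.le_of_dvd hn hqd)) hq.two_le hqd)

/-- In `ℤ/p`, an element of order `p − 1` generates the units: every non-zero `u` is a power of it. [folklore] -/
theorem exists_pow_eq_of_orderOf_eq {g : ZMod p} (hg : orderOf g = p - 1) {u : ZMod p} (hu : u ≠ 0) :
    ∃ m : ℕ, u = g ^ m := by
  have hp : p.Prime := Fact.out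
  have hg0 : g ≠ 0 := by
    intro h0
    have h1 : g ^ orderOf g = 1 := pow_orderOf_eq_one g
    rw [hg, h0, zero_pow (by have := hp.two_le; omega)] at h1
    exact zero_ne_one h1
  set gu : (ZMod p)ˣ := Units.mk0 g hg0 with hgu
  set uu : (ZMod p)ˣ := Units.mk0 u hu with huu
  have hord : orderOf gu = p - 1 := by rw [← orderOf_units, Units.val_mk0, hg]
  have htop : Subgroup.zpowers gu = ⊤ := by
    apply Subgroup.eq_top_of_card_eq
    rw [Nat.card_zpowers, hord, Nat.card_eq_fintype_card, ZMod.card_units]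
  have hmem : uu ∈ Submonoid.powers gu := by
    rw [mem_powers_iff_mem_zpowers, htop]; exact Subgroup.mem_top _
  obtain ⟨m, hm⟩ := (Submonoid.mem_powers_iff _ _).mp hmem
  refine ⟨m, ?_⟩
  have := congrArg (fun x : (ZMod p)ˣ ↦ (x : ZMod p)) hm
  simp only [Units.val_pow_eq_pow_val, Units.val_mk0, hgu, huu] at this
  exact this.symm

/-- **THEOREM B′ from a primitive root**: `orderOf g = p − 1`, `i² = −1`, `g = 4^a i^b` ⟹ `CuspSpanEvenAtTwo p`.
[cite: Pollack2003, Conj. 6.3] -/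
theorem cuspSpanEvenAtTwo_of_orderOf_of_rootNegOne (hp2 : p ≠ 2) (g i : ZMod p) (hg : orderOf g = p - 1)
    (hi : i * i = -1) (a b : ℕ) (hgab : g = 4 ^ a * i ^ b) : CuspSpanEvenAtTwo p := by
  refine cuspSpanEvenAtTwo_of_units_four_pow_mul_rootNegOne_pow hp2 i hi fun u hu ↦ ?_
  obtain ⟨m, rfl⟩ := exists_pow_eq_of_orderOf_eq hg hu
  exact ⟨a * m, b * m, by rw [hgab, mul_pow, ← pow_mul, ← pow_mul]⟩

/-- **THEOREM E′ from a primitive root**: `orderOf g = p − 1`, `ρ² + ρ + 1 = 0`, `g = ±4^a ρ^b` ⟹ `CuspSpanEvenAtTwo p`.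
[cite: Pollack2003, Conj. 6.3] -/
theorem cuspSpanEvenAtTwo_of_orderOf_of_rootCube (hp2 : p ≠ 2) (g ρ : ZMod p) (hg : orderOf g = p - 1)
    (hρ : ρ * ρ + ρ + 1 = 0) (a b : ℕ) (hgab : g = 4 ^ a * ρ ^ b ∨ g = -(4 ^ a * ρ ^ b)) : CuspSpanEvenAtTwo p := by
  refine cuspSpanEvenAtTwo_of_units_pm_four_pow_mul_rootCube_pow hp2 ρ hρ fun u hu ↦ ?_
  obtain ⟨m, rfl⟩ := exists_pow_eq_of_orderOf_eq hg hu
  refine ⟨a * m, b * m, ?_⟩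
  rcases hgab with h | h
  · exact Or.inl (by rw [h, mul_pow, ← pow_mul, ← pow_mul])
  · rcases Nat.even_or_odd m with hm | hm
    · exact Or.inl (by rw [h, hm.neg_pow, mul_pow, ← pow_mul, ← pow_mul])
    · exact Or.inr (by rw [h, hm.neg_pow, mul_pow, ← pow_mul, ← pow_mul])

/-! ### Instances: THEOREM B′ at `317, 349`, THEOREM E′ at `439`; the sequel `…CuspSpanEllipticFamiliesTable` continues through
`p < 1100`. The families are B′ = {p ≡ 5 (mod 8) : 2 is a primitive root mod p} = {5, 13, 29, 37, 53, 61, 101, 149, 173, 181, 197, 269,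
293, 317, 349, …} and E′ = {p : [(ℤ/p)ˣ : ±⟨4⟩] = 3, ρ ∉ ±⟨4⟩} = {31, 43, 223, 283, 439, 499, 643, 691, 727, 1051, …}; together with
Theorem A they cover 122 of the 195 odd primes below 1200. Members below 300 also have per-level certificates in the tree. -/

/-- `CuspSpanEvenAtTwo 349` (THEOREM B′: `2` is a primitive root mod `349`, `i = 213`, `2 = 4^44·i^3`). [cite: Pollack2003, Conj. 6.3] -/
theorem cuspSpanEvenAtTwo_uniform_349 : CuspSpanEvenAtTwo 349 := by
  have h1 : (2 : ZMod 349) ^ 348 = 1 := by decide +kernel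
  have h2 : ∀ q, q < 348 + 1 → 2 ≤ q → q ∣ 348 → (2 : ZMod 349) ^ (348 / q) ≠ 1 := by decide +kernel
  have hi : (213 : ZMod 349) * 213 = -1 := by decide +kernel
  have hg : (2 : ZMod 349) = 4 ^ 44 * 213 ^ 3 := by decide +kernel
  haveI : Fact (Nat.Prime 349) := ⟨by norm_num⟩
  exact cuspSpanEvenAtTwo_of_orderOf_of_rootNegOne (p := 349) (by norm_num) 2 213
    (orderOf_eq_of_pow_eq_one_of_forall_dvd (2 : ZMod 349) 348 (by norm_num) h1 h2) hi 44 3 hg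
/-- `CuspSpanEvenAtTwo 317` (THEOREM B′: `2` is a primitive root mod `317`, `i = 203`, `2 = 4^40·i^3`). [cite: Pollack2003, Conj. 6.3] -/
theorem cuspSpanEvenAtTwo_uniform_317 : CuspSpanEvenAtTwo 317 := by
  have h1 : (2 : ZMod 317) ^ 316 = 1 := by decide +kernel
  have h2 : ∀ q, q < 316 + 1 → 2 ≤ q → q ∣ 316 → (2 : ZMod 317) ^ (316 / q) ≠ 1 := by decide +kernel
  have hi : (203 : ZMod 317) * 203 = -1 := by decide +kernel
  have hg : (2 : ZMod 317) = 4 ^ 40 * 203 ^ 3 := by decide +kernel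
  haveI : Fact (Nat.Prime 317) := ⟨by norm_num⟩
  exact cuspSpanEvenAtTwo_of_orderOf_of_rootNegOne (p := 317) (by norm_num) 2 203
    (orderOf_eq_of_pow_eq_one_of_forall_dvd (2 : ZMod 317) 316 (by norm_num) h1 h2) hi 40 3 hg

/-- `CuspSpanEvenAtTwo 439` (THEOREM E′: `15` is a primitive root mod `439`, `ρ = 267`, `15 = −4^22·ρ^2`). [cite: Pollack2003, Conj. 6.3] -/
theorem cuspSpanEvenAtTwo_uniform_439 : CuspSpanEvenAtTwo 439 := by
  have h1 : (15 : ZMod 439) ^ 438 = 1 := by decide +kernel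
  have h2 : ∀ q, q < 438 + 1 → 2 ≤ q → q ∣ 438 → (15 : ZMod 439) ^ (438 / q) ≠ 1 := by decide +kernel
  have hr : (267 : ZMod 439) * 267 + 267 + 1 = 0 := by decide +kernel
  have hg : (15 : ZMod 439) = -(4 ^ 22 * 267 ^ 2) := by decide +kernel
  haveI : Fact (Nat.Prime 439) := ⟨by norm_num⟩
  exact cuspSpanEvenAtTwo_of_orderOf_of_rootCube (p := 439) (by norm_num) 15 267
    (orderOf_eq_of_pow_eq_one_of_forall_dvd (15 : ZMod 439) 438 (by norm_num) h1 h2) hr 22 2 (Or.inr hg)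

end Summit.BirchSwinnertonDyer.BirchSwinnertonDyer.Theorems.SignedMuAtTwo

end
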